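import Mathlib
import Literature.Analysis.FluidPDE.GaussianVortexPlanar
import Literature.Analysis.Calculus.PlanarPolarIntegral

/-!
# crux CoreGluingGivenInvertibilityQR, line Sketch, stub stub_qrAmbientRotationSkew — the tilt term
# `−ω∂_θ` is skew in the radial weight `G_λ`

At a tilted core station of the filament skeleton the planar linearised core operator is
`L_λ − ω∂_θ − RΛ_G` (`ω` = frame-rotation component along the core axis). The tilt term is invisible
in every energy identity taken in the radial Gaussian weight `G_λ⁻¹`
(`G_λ = Literature.Analysis.FluidPDE.gaussWeightLam lam`) of the crux `CoreLinearInvertibility`: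
`∫ G_λ⁻¹ w ∂_θ w = 0`, `∂_θ w = x₀∂₁w − x₁∂₀w`, for `w ∈ C¹(ℝ²)` with `G_λ⁻¹ |x| |w| |∇w|`
integrable. Proof: polar Fubini on `EuclideanSpace ℝ (Fin 2)`
(`Literature.Analysis.Calculus.integral_euclidean_eq_integral_Ioi_integral_Ioo_polar`); on each circle
`|x| = ρ` the weight is constant, `G_λ⁻¹ w ∂_θ w = ∂_θ(½ G_λ(ρ)⁻¹ w²)`, and the angular integral of
an exact `θ`-derivative over `(−π, π)` vanishes by the fundamental theorem of calculus and
`2π`-periodicity of `(ρ cos θ, ρ sin θ)`.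
-/

set_option linter.dupNamespace false

noncomputable section

namespace Summit.NavierStokesRegularity.NavierStokesRegularity.Theorems

open MeasureTheory Real Set Filter Topology
open scoped InnerProductSpace
open Literature.Analysis.FluidPDE

/-- A coordinate vector of the plane in the standard basis: `(a, b) = a e₀ + b e₁`. [folklore] -/
theorem qrRot_toLp_fin_two_eq_smul_add (a b : ℝ) :
    (WithLp.toLp 2 ![a, b] : EuclideanSpace ℝ (Fin 2)) =
      a • EuclideanSpace.single 0 1 + b • EuclideanSpace.single 1 1 := by
  ext i
  fin_cases i <;> simp

/-- The angular derivative of the polar curve `θ ↦ (ρ cos θ, ρ sin θ)` is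
`x^⊥ = −x₁ e₀ + x₀ e₁`. [folklore] -/
theorem qrRot_hasDerivAt_polarCurve (ρ θ : ℝ) :
    HasDerivAt (fun θ : ℝ => (WithLp.toLp 2 ![ρ * cos θ, ρ * sin θ] : EuclideanSpace ℝ (Fin 2)))
      ((-(ρ * sin θ)) • EuclideanSpace.single 0 1 + (ρ * cos θ) • EuclideanSpace.single 1 1) θ := by
  simp_rw [qrRot_toLp_fin_two_eq_smul_add]
  refine (HasDerivAt.smul_const ?_ _).add (HasDerivAt.smul_const ?_ _)
  · exact ((hasDerivAt_cos θ).const_mul ρ).congr_deriv (by ring)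
  · exact (hasDerivAt_sin θ).const_mul ρ

/-- The polar curve is continuous in the angle. [folklore] -/
theorem qrRot_continuous_polarCurve (ρ : ℝ) :
    Continuous fun θ : ℝ => (WithLp.toLp 2 ![ρ * cos θ, ρ * sin θ] : EuclideanSpace ℝ (Fin 2)) :=
  continuous_iff_continuousAt.2 fun θ => (qrRot_hasDerivAt_polarCurve ρ θ).continuousAt

/-- `|(ρ cos θ, ρ sin θ)|² = ρ²`. [folklore] -/
theorem qrRot_norm_sq_polarCurve (ρ θ : ℝ) :
    ‖(WithLp.toLp 2 ![ρ * cos θ, ρ * sin θ] : EuclideanSpace ℝ (Fin 2))‖ ^ 2 = ρ ^ 2 := by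
  rw [EuclideanSpace.real_norm_sq_eq, Fin.sum_univ_two]
  simp only [Matrix.cons_val_zero, Matrix.cons_val_one, Matrix.cons_val_fin_one]
  linear_combination ρ ^ 2 * cos_sq_add_sin_sq θ

/-- The polar curve is `2π`-periodic: its values at `θ = ±π` agree. [folklore] -/
theorem qrRot_polarCurve_pi_eq (ρ : ℝ) :
    (WithLp.toLp 2 ![ρ * cos π, ρ * sin π] : EuclideanSpace ℝ (Fin 2)) =
      WithLp.toLp 2 ![ρ * cos (-π), ρ * sin (-π)] := by
  rw [cos_neg, sin_neg, sin_pi, neg_zero]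

/-- `|x₀ ∂₁w − x₁ ∂₀w| ≤ |x| |∇w|`: the angular derivative is `Dw[x^⊥]` with `|x^⊥| = |x|` and
`|∇w| = ‖Dw‖`. [folklore] -/
theorem qrRot_abs_angularDeriv_le (w : EuclideanSpace ℝ (Fin 2) → ℝ) (x : EuclideanSpace ℝ (Fin 2)) :
    |x 0 * fderiv ℝ w x (EuclideanSpace.single 1 1) - x 1 * fderiv ℝ w x (EuclideanSpace.single 0 1)| ≤
      ‖x‖ * ‖gradient w x‖ := by
  have hv : x 0 * fderiv ℝ w x (EuclideanSpace.single 1 1) -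
      x 1 * fderiv ℝ w x (EuclideanSpace.single 0 1) =
      fderiv ℝ w x (x 0 • EuclideanSpace.single 1 1 - x 1 • EuclideanSpace.single 0 1) := by
    rw [map_sub, map_smul, map_smul, smul_eq_mul, smul_eq_mul]
  have hn : ‖(x 0 • EuclideanSpace.single 1 1 - x 1 • EuclideanSpace.single 0 1 :
      EuclideanSpace ℝ (Fin 2))‖ = ‖x‖ := by
    have h2 : ‖(x 0 • EuclideanSpace.single 1 1 - x 1 • EuclideanSpace.single 0 1 :
        EuclideanSpace ℝ (Fin 2))‖ ^ 2 = ‖x‖ ^ 2 := by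
      rw [EuclideanSpace.real_norm_sq_eq, EuclideanSpace.real_norm_sq_eq, Fin.sum_univ_two,
        Fin.sum_univ_two]
      simp
      ring
    rw [← Real.sqrt_sq (norm_nonneg _), h2, Real.sqrt_sq (norm_nonneg _)]
  rw [hv, ← Real.norm_eq_abs, gradient, LinearIsometryEquiv.norm_map, mul_comm]
  calc ‖fderiv ℝ w x (x 0 • EuclideanSpace.single 1 1 - x 1 • EuclideanSpace.single 0 1)‖
      ≤ ‖fderiv ℝ w x‖ * ‖(x 0 • EuclideanSpace.single 1 1 - x 1 • EuclideanSpace.single 0 1 :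
          EuclideanSpace ℝ (Fin 2))‖ := ContinuousLinearMap.le_opNorm _ _
    _ = ‖fderiv ℝ w x‖ * ‖x‖ := by rw [hn]

/-- **The integral of an exact angular derivative vanishes.** If `F` is continuous and integrable on
the plane and on every circle `θ ↦ F(ρ cos θ, ρ sin θ)` is the derivative of a function `H ρ` with
`H ρ π = H ρ (−π)`, then `∫ F = 0` (polar Fubini + the fundamental theorem of calculus). [folklore] -/
theorem qrRot_integral_eq_zero_of_hasDerivAt_polar {F : EuclideanSpace ℝ (Fin 2) → ℝ}
    {H : ℝ → ℝ → ℝ} (hFi : Integrable F) (hFc : Continuous F)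
    (hH : ∀ ρ θ, HasDerivAt (H ρ) (F (WithLp.toLp 2 ![ρ * cos θ, ρ * sin θ])) θ)
    (hper : ∀ ρ, H ρ π = H ρ (-π)) : ∫ x, F x = 0 := by
  rw [Literature.Analysis.Calculus.integral_euclidean_eq_integral_Ioi_integral_Ioo_polar hFi]
  have hinner : ∀ ρ : ℝ,
      ∫ θ in Ioo (-π) π, ρ • F (WithLp.toLp 2 ![ρ * cos θ, ρ * sin θ]) = 0 := by
    intro ρ
    have hcont : Continuous fun θ : ℝ => F (WithLp.toLp 2 ![ρ * cos θ, ρ * sin θ]) :=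
      hFc.comp' (qrRot_continuous_polarCurve ρ)
    simp_rw [smul_eq_mul]
    rw [integral_const_mul, ← integral_Ioc_eq_integral_Ioo,
      ← intervalIntegral.integral_of_le (by linarith [pi_pos] : -π ≤ π),
      intervalIntegral.integral_eq_sub_of_hasDerivAt (fun θ _ => hH ρ θ)
        (hcont.intervalIntegrable _ _),
      hper, sub_self, mul_zero]
  simp only [hinner, integral_zero]

/-- **The tilt term `−ω∂_θ` is skew in every radial Gaussian weight `G_λ`, `λ < 1`**:
`∫ G_λ⁻¹ w ∂_θ w = 0` with `∂_θ w = x₀∂₁w − x₁∂₀w`, for `w ∈ C¹(ℝ²)` such that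
`G_λ⁻¹ |x| |w| |∇w|` is integrable (the hypothesis on `G_λ⁻¹ w²` is not needed). On each circle
`G_λ` is constant and `G_λ⁻¹ w ∂_θ w = ∂_θ(½ G_λ⁻¹ w²)` integrates to zero in `θ`; polar Fubini
(`qrRot_integral_eq_zero_of_hasDerivAt_polar`). [folklore] -/
theorem stub_qrAmbientRotationSkew :
    ∀ (lam : ℝ) (w : EuclideanSpace ℝ (Fin 2) → ℝ), lam < 1 → ContDiff ℝ 1 w →
      Integrable (fun x => (gaussWeightLam lam x)⁻¹ * w x ^ 2) →
      Integrable (fun x => (gaussWeightLam lam x)⁻¹ * (‖x‖ * (|w x| * ‖gradient w x‖))) →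
      ∫ x, (gaussWeightLam lam x)⁻¹ *
          (w x * (x 0 * fderiv ℝ w x (EuclideanSpace.single 1 1) -
            x 1 * fderiv ℝ w x (EuclideanSpace.single 0 1))) = 0 := by
  intro lam w hlam hw _ hint
  -- positivity and continuity of the weight, continuity of the first derivatives
  have hGpos : ∀ x, 0 < gaussWeightLam lam x := fun x => by
    have h1 : 0 < 1 - lam := by linarith
    unfold gaussWeightLam
    positivity
  have hGc : Continuous fun x : EuclideanSpace ℝ (Fin 2) => gaussWeightLam lam x := by
    simp only [gaussWeightLam]
    fun_prop
  have hGinv : Continuous fun x : EuclideanSpace ℝ (Fin 2) => (gaussWeightLam lam x)⁻¹ :=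
    hGc.inv₀ fun x => (hGpos x).ne'
  have hwd : ∀ x, HasFDerivAt w (fderiv ℝ w x) x := fun x =>
    (hw.differentiable one_ne_zero x).hasFDerivAt
  have hDc : ∀ v : EuclideanSpace ℝ (Fin 2), Continuous fun x => fderiv ℝ w x v := fun v =>
    (hw.continuous_fderiv one_ne_zero).clm_apply continuous_const
  -- the integrand is continuous and integrable
  set F : EuclideanSpace ℝ (Fin 2) → ℝ := fun x => (gaussWeightLam lam x)⁻¹ *
    (w x * (x 0 * fderiv ℝ w x (EuclideanSpace.single 1 1) -
      x 1 * fderiv ℝ w x (EuclideanSpace.single 0 1))) with hF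
  have hFc : Continuous F :=
    hGinv.mul (hw.continuous.mul (((PiLp.continuous_apply 2 _ 0).mul (hDc _)).sub
      ((PiLp.continuous_apply 2 _ 1).mul (hDc _))))
  have hFi : Integrable F := by
    refine hint.mono' hFc.aestronglyMeasurable (Eventually.of_forall fun x => ?_)
    rw [Real.norm_eq_abs, hF]
    dsimp only
    rw [abs_mul, abs_mul, abs_of_pos (inv_pos.2 (hGpos x))]
    refine mul_le_mul_of_nonneg_left ?_ (inv_pos.2 (hGpos x)).le
    have h := qrRot_abs_angularDeriv_le w x
    have hw0 : 0 ≤ |w x| := abs_nonneg _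
    calc |w x| * |x 0 * fderiv ℝ w x (EuclideanSpace.single 1 1) -
          x 1 * fderiv ℝ w x (EuclideanSpace.single 0 1)|
        ≤ |w x| * (‖x‖ * ‖gradient w x‖) := mul_le_mul_of_nonneg_left h hw0
      _ = ‖x‖ * (|w x| * ‖gradient w x‖) := by ring
  -- on circles the weight is constant
  set g : ℝ → ℝ := fun ρ => (1 - lam) / (4 * π) * Real.exp (-((1 - lam) / 4 * ρ ^ 2)) with hg
  have hGpol : ∀ ρ θ : ℝ,
      gaussWeightLam lam (WithLp.toLp 2 ![ρ * cos θ, ρ * sin θ]) = g ρ := fun ρ θ => by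
    simp only [hg, gaussWeightLam, qrRot_norm_sq_polarCurve]
  -- the chain rule along circles: `∂_θ (w ∘ polar) = −ρ sin θ ∂₀w + ρ cos θ ∂₁w`
  have hcomp : ∀ ρ θ : ℝ, HasDerivAt (fun θ : ℝ => w (WithLp.toLp 2 ![ρ * cos θ, ρ * sin θ]))
      (-(ρ * sin θ) * fderiv ℝ w (WithLp.toLp 2 ![ρ * cos θ, ρ * sin θ]) (EuclideanSpace.single 0 1) +
        ρ * cos θ * fderiv ℝ w (WithLp.toLp 2 ![ρ * cos θ, ρ * sin θ]) (EuclideanSpace.single 1 1))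
      θ := by
    intro ρ θ
    have h := (hwd _).comp_hasDerivAt θ (qrRot_hasDerivAt_polarCurve ρ θ)
    rw [map_add, map_smul, map_smul, smul_eq_mul, smul_eq_mul] at h
    exact h
  refine qrRot_integral_eq_zero_of_hasDerivAt_polar hFi hFc
    (H := fun ρ θ => (g ρ)⁻¹ / 2 * (w (WithLp.toLp 2 ![ρ * cos θ, ρ * sin θ]) *
      w (WithLp.toLp 2 ![ρ * cos θ, ρ * sin θ]))) (fun ρ θ => ?_) (fun ρ => ?_)
  · refine (((hcomp ρ θ).mul (hcomp ρ θ)).const_mul ((g ρ)⁻¹ / 2)).congr_deriv ?_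
    simp only [hGpol, Matrix.cons_val_zero, Matrix.cons_val_one, Matrix.cons_val_fin_one]
    ring
  · simp only [qrRot_polarCurve_pi_eq]

end Summit.NavierStokesRegularity.NavierStokesRegularity.Theorems
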